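import Mathlib.Algebra.MvPolynomial.Equiv
import Literature.Barriers.ValiantsHypothesis.FullRankMultilinearFormulaLowerBound
import HarnessLib

/-!
# Multilinear formulas can be made syntactically multilinear (Raz 2006, Prop. 2.1)

[Raz2006, Prop. 2.1]: "For any multilinear formula, there exists a syntactic multilinear formula of
the same size that computes the same polynomial."  A formula is MULTILINEAR if every node computes
a multilinear polynomial; the proof replaces, at every product node whose children share a
variable `x`, the occurrences of `x` by `0` in the child whose polynomial does not depend on `x`
(one of them does not, the product being multilinear).  On the tree type `WExpr`:

* `substZero x e` — replace the leaves `x` by the constant `0`: same size, variable set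
  `varSet e \\ {x}`, value `e.eval` with `x ↦ 0` (`eval_substZero`), hence unchanged when `x` does
  not occur in `e.eval` (`eval_substZero_of_notMem_vars`); preserves syntactic multilinearity;
* `degreeOf_mul_eq` — over a domain, `deg_x (f g) = deg_x f + deg_x g` for `f, g ≠ 0`
  (so a multilinear product has no variable occurring in both factors);
* `IsMultilinearFormula`, **`exists_syntMultilinear`** — Prop. 2.1 (size `≤`);
* `not_isFullRank_of_multilinearFormula` — consequently Raz's theorem
  (`not_isFullRank_of_syntMultilinear`) for MULTILINEAR formulas: for every `b`, eventually, no
  multilinear formula of size `≤ u^b` computes a full-rank polynomial. [Raz2006, Cor. 3.6]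

## References
* [Raz2006] R. Raz, *Separation of multilinear circuit and formula size*, Theory of Computing 2
  (2006) 121–135, §2 (Prop. 2.1), Cor. 3.6.
-/

noncomputable section

namespace Literature.Barriers.ValiantsHypothesis.RazFormula

open MvPolynomial Finset Literature.Computability.AlgebraicComplexity
open Literature.Computability.AlgebraicComplexity.WExpr

universe u v

variable {k : Type u} {σ : Type v} [DecidableEq σ]

/-! ### Replacing a variable by `0` in a formula -/

/-- Replace every leaf `x` by the constant `0` ("every occurrence of `x_i` in `Φ_{v_1}` can be
replaced by the constant `0`"). [cite: Raz2006, Prop. 2.1 (proof)] -/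
def substZero [Zero k] (x : σ) : WExpr k σ → WExpr k σ
  | .var i => if i = x then .const 0 else .var i
  | .const c => .const c
  | .lin c₁ e₁ c₂ e₂ => .lin c₁ (substZero x e₁) c₂ (substZero x e₂)
  | .mul e₁ e₂ => .mul (substZero x e₁) (substZero x e₂)

/-- Same size. [cite: Raz2006, Prop. 2.1] -/
theorem size_substZero [Zero k] (x : σ) : ∀ e : WExpr k σ, (substZero x e).size = e.size
  | .var i => by unfold substZero; split_ifs <;> rfl
  | .const c => rfl
  | .lin c₁ e₁ c₂ e₂ => by simp [substZero, size_substZero x e₁, size_substZero x e₂]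
  | .mul e₁ e₂ => by simp [substZero, size_substZero x e₁, size_substZero x e₂]

/-- The variable set loses `x`. [cite: Raz2006, Prop. 2.1] -/
theorem varSet_substZero [Zero k] (x : σ) : ∀ e : WExpr k σ, varSet (substZero x e) = (varSet e).erase x
  | .var i => by
    unfold substZero
    split_ifs with h
    · subst h; simp
    · have h' : x ∉ ({i} : Finset σ) := by
        rw [Finset.mem_singleton]; exact fun h'' => h h''.symm
      simp [Finset.erase_eq_of_notMem h']
  | .const c => by simp [substZero]
  | .lin c₁ e₁ c₂ e₂ => by
    rw [substZero, varSet_lin, varSet_lin, varSet_substZero x e₁, varSet_substZero x e₂, Finset.erase_union_distrib]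
  | .mul e₁ e₂ => by
    rw [substZero, varSet_mul, varSet_mul, varSet_substZero x e₁, varSet_substZero x e₂, Finset.erase_union_distrib]

/-- Syntactic multilinearity is preserved (variable sets only shrink). [cite: Raz2006, Prop. 2.1] -/
theorem isSyntMultilinear_substZero [Zero k] (x : σ) :
    ∀ {e : WExpr k σ}, IsSyntMultilinear e → IsSyntMultilinear (substZero x e)
  | .var i, _ => by unfold substZero; split_ifs <;> trivial
  | .const c, _ => trivial
  | .lin c₁ e₁ c₂ e₂, h => ⟨isSyntMultilinear_substZero x h.1, isSyntMultilinear_substZero x h.2⟩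
  | .mul e₁ e₂, h => by
    refine ⟨isSyntMultilinear_substZero x h.1, isSyntMultilinear_substZero x h.2.1, ?_⟩
    rw [varSet_substZero, varSet_substZero]
    exact h.2.2.mono (Finset.erase_subset _ _) (Finset.erase_subset _ _)

variable [CommRing k]

/-- The value: `e.eval` with `x ↦ 0`. [cite: Raz2006, Prop. 2.1] -/
theorem eval_substZero (x : σ) : ∀ e : WExpr k σ,
    (substZero x e).eval = aeval (fun i => if i = x then (0 : MvPolynomial σ k) else X i) e.eval
  | .var i => by
    unfold substZero
    split_ifs with h
    · subst h; simp
    · simp [h]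
  | .const c => by simp [substZero]
  | .lin c₁ e₁ c₂ e₂ => by
    rw [substZero, eval_lin, eval_lin, eval_substZero x e₁, eval_substZero x e₂, map_add, map_smul, map_smul]
  | .mul e₁ e₂ => by
    rw [substZero, WExpr.eval_mul, WExpr.eval_mul, eval_substZero x e₁, eval_substZero x e₂, map_mul]

/-- Setting `x ↦ 0` does not change a polynomial in which `x` does not occur. [folklore] -/
private theorem aeval_killVar_eq_self {x : σ} {f : MvPolynomial σ k} (hx : x ∉ f.vars) :
    aeval (fun i => if i = x then (0 : MvPolynomial σ k) else X i) f = f := by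
  obtain ⟨g, rfl⟩ := exists_rename_eq_of_vars_subset_range f ((↑) : {i : σ // i ≠ x} → σ)
    Subtype.val_injective (fun i hi => ⟨⟨i, fun h => hx (h ▸ hi)⟩, rfl⟩)
  rw [aeval_rename]
  have : ((fun i => if i = x then (0 : MvPolynomial σ k) else X i) ∘ ((↑) : {i : σ // i ≠ x} → σ)) =
      fun j => X j.1 := by
    funext j; simp [j.2]
  rw [this, ← aeval_X_left_apply (rename ((↑) : {i : σ // i ≠ x} → σ) g), aeval_rename]
  rfl

/-- Hence `substZero x` does not change the value of a formula whose polynomial misses `x`.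
[cite: Raz2006, Prop. 2.1 (proof)] -/
theorem eval_substZero_of_notMem_vars {x : σ} {e : WExpr k σ} (hx : x ∉ e.eval.vars) :
    (substZero x e).eval = e.eval := by
  rw [eval_substZero, aeval_killVar_eq_self hx]

/-! ### Degree of a variable in a product over a domain -/

/-- **`deg_x (f g) = deg_x f + deg_x g`** for nonzero `f, g` over a domain — the fact behind
"since `Φ_v` is multilinear, in at least one of `Φ_{v₁}, Φ_{v₂}` the variable `x_i` doesn't occur".
[cite: Raz2006, Prop. 2.1 (proof)] -/
theorem degreeOf_mul_eq {K : Type u} [Field K] (x : σ) {f g : MvPolynomial σ K} (hf : f ≠ 0) (hg : g ≠ 0) :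
    degreeOf x (f * g) = degreeOf x f + degreeOf x g := by
  rw [degreeOf_eq_natDegree, degreeOf_eq_natDegree, degreeOf_eq_natDegree, map_mul, map_mul,
    Polynomial.natDegree_mul]
  · intro h
    apply hf
    have h' : rename (Equiv.optionSubtypeNe x).symm f = 0 := by simpa using h
    exact rename_injective _ (Equiv.optionSubtypeNe x).symm.injective (by rw [h', map_zero])
  · intro h
    apply hg
    have h' : rename (Equiv.optionSubtypeNe x).symm g = 0 := by simpa using h
    exact rename_injective _ (Equiv.optionSubtypeNe x).symm.injective (by rw [h', map_zero])

/-! ### Multilinear formulas (Raz 2006, §2) and Prop. 2.1 -/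

/-- **Multilinear formula**: every node computes a multilinear polynomial (degree `≤ 1` in each
variable). [cite: Raz2006, §2] -/
def IsMultilinearFormula : WExpr k σ → Prop
  | .var _ => True
  | .const _ => True
  | .lin c₁ e₁ c₂ e₂ => IsMultilinearFormula e₁ ∧ IsMultilinearFormula e₂ ∧
      ∀ x, degreeOf x (WExpr.eval (.lin c₁ e₁ c₂ e₂)) ≤ 1
  | .mul e₁ e₂ => IsMultilinearFormula e₁ ∧ IsMultilinearFormula e₂ ∧
      ∀ x, degreeOf x (WExpr.eval (.mul e₁ e₂)) ≤ 1

/-- **Raz 2006, Prop. 2.1.**  Every multilinear formula can be replaced by a syntactically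
multilinear formula of at most the same size computing the same polynomial (over a field).
[cite: Raz2006, Prop. 2.1] -/
theorem exists_syntMultilinear {K : Type u} [Field K] :
    ∀ {e : WExpr K σ}, IsMultilinearFormula e →
      ∃ e' : WExpr K σ, IsSyntMultilinear e' ∧ e'.eval = e.eval ∧ e'.size ≤ e.size
  | .var i, _ => ⟨.var i, trivial, rfl, le_rfl⟩
  | .const c, _ => ⟨.const c, trivial, rfl, le_rfl⟩
  | .lin c₁ e₁ c₂ e₂, h => by
    obtain ⟨e₁', h₁, hev₁, hs₁⟩ := exists_syntMultilinear h.1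
    obtain ⟨e₂', h₂, hev₂, hs₂⟩ := exists_syntMultilinear h.2.1
    exact ⟨.lin c₁ e₁' c₂ e₂', ⟨h₁, h₂⟩, by rw [eval_lin, eval_lin, hev₁, hev₂],
      by rw [size_lin, size_lin]; omega⟩
  | .mul e₁ e₂, h => by
    classical
    obtain ⟨e₁', h₁, hev₁, hs₁⟩ := exists_syntMultilinear h.1
    obtain ⟨e₂', h₂, hev₂, hs₂⟩ := exists_syntMultilinear h.2.1
    set f := e₁.eval with hf
    set g := e₂.eval with hg
    by_cases hzero : f = 0 ∨ g = 0
    · refine ⟨.const 0, trivial, ?_, by simp⟩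
      rw [eval_const, WExpr.eval_mul, map_zero]
      rcases hzero with h0 | h0
      · rw [← hf, h0, zero_mul]
      · rw [← hg, h0, mul_zero]
    push Not at hzero
    -- no variable occurs in both `f` and `g`
    have hml : ∀ x, degreeOf x (f * g) ≤ 1 := h.2.2
    have hsep : ∀ x, degreeOf x f = 0 ∨ degreeOf x g = 0 := by
      intro x
      have := hml x
      rw [degreeOf_mul_eq x hzero.1 hzero.2] at this
      omega
    -- kill the syntactically shared variables one by one
    let step : σ → WExpr K σ × WExpr K σ → WExpr K σ × WExpr K σ := fun x p =>
      if degreeOf x f = 0 then (substZero x p.1, p.2) else (p.1, substZero x p.2)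
    have hstep : ∀ (x : σ) (p : WExpr K σ × WExpr K σ),
        IsSyntMultilinear p.1 → IsSyntMultilinear p.2 → p.1.eval = f → p.2.eval = g →
          IsSyntMultilinear (step x p).1 ∧ IsSyntMultilinear (step x p).2 ∧
            (step x p).1.eval = f ∧ (step x p).2.eval = g ∧
            (step x p).1.size = p.1.size ∧ (step x p).2.size = p.2.size ∧
            varSet (step x p).1 ⊆ varSet p.1 ∧ varSet (step x p).2 ⊆ varSet p.2 ∧
            ¬ (x ∈ varSet (step x p).1 ∧ x ∈ varSet (step x p).2) := by
      intro x p hp1 hp2 he1 he2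
      simp only [step]
      split_ifs with hdx
      · refine ⟨isSyntMultilinear_substZero x hp1, hp2, ?_, he2, size_substZero x _, rfl,
          by rw [varSet_substZero]; exact Finset.erase_subset _ _, subset_refl _, ?_⟩
        · rw [← he1] at hdx
          rw [eval_substZero_of_notMem_vars (fun hm => (mem_vars_iff_degreeOf_ne_zero.1 hm) hdx), he1]
        · rw [varSet_substZero]; simp
      · have hdg : degreeOf x g = 0 := (hsep x).resolve_left hdx
        refine ⟨hp1, isSyntMultilinear_substZero x hp2, he1, ?_, rfl, size_substZero x _,
          subset_refl _, by rw [varSet_substZero]; exact Finset.erase_subset _ _, ?_⟩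
        · rw [← he2] at hdg
          rw [eval_substZero_of_notMem_vars (fun hm => (mem_vars_iff_degreeOf_ne_zero.1 hm) hdg), he2]
        · rw [varSet_substZero]; simp
    -- iterate over the list of shared variables
    have hiter : ∀ (xs : List σ) (p : WExpr K σ × WExpr K σ),
        IsSyntMultilinear p.1 → IsSyntMultilinear p.2 → p.1.eval = f → p.2.eval = g →
          let q := xs.foldr step p
          IsSyntMultilinear q.1 ∧ IsSyntMultilinear q.2 ∧ q.1.eval = f ∧ q.2.eval = g ∧
            q.1.size = p.1.size ∧ q.2.size = p.2.size ∧
            varSet q.1 ⊆ varSet p.1 ∧ varSet q.2 ⊆ varSet p.2 ∧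
            ∀ x ∈ xs, ¬ (x ∈ varSet q.1 ∧ x ∈ varSet q.2) := by
      intro xs
      induction xs with
      | nil => intro p hp1 hp2 he1 he2; exact ⟨hp1, hp2, he1, he2, rfl, rfl, subset_refl _, subset_refl _, by simp⟩
      | cons x xs ih =>
        intro p hp1 hp2 he1 he2
        obtain ⟨i1, i2, i3, i4, i5, i6, i7, i8, i9⟩ := ih p hp1 hp2 he1 he2
        obtain ⟨s1, s2, s3, s4, s5, s6, s7, s8, s9⟩ := hstep x (xs.foldr step p) i1 i2 i3 i4
        simp only [List.foldr_cons]
        refine ⟨s1, s2, s3, s4, s5.trans i5, s6.trans i6, s7.trans i7, s8.trans i8, ?_⟩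
        intro y hy
        rw [List.mem_cons] at hy
        rcases hy with rfl | hy
        · exact s9
        · exact fun hb => i9 y hy ⟨s7 hb.1, s8 hb.2⟩
    obtain ⟨q1, q2, q3, q4, q5, q6, q7, q8, q9⟩ :=
      hiter (varSet e₁' ∩ varSet e₂').toList (e₁', e₂') h₁ h₂ hev₁ hev₂
    set q := (varSet e₁' ∩ varSet e₂').toList.foldr step (e₁', e₂') with hq
    refine ⟨.mul q.1 q.2, ⟨q1, q2, ?_⟩, ?_, ?_⟩
    · rw [Finset.disjoint_left]
      intro y hy1 hy2
      exact q9 y (Finset.mem_toList.2 (Finset.mem_inter.2 ⟨q7 hy1, q8 hy2⟩)) ⟨hy1, hy2⟩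
    · rw [WExpr.eval_mul, WExpr.eval_mul, q3, q4]
    · rw [size_mul, size_mul, q5, q6]; simp only; omega

/-- **Raz's theorem for MULTILINEAR formulas.**  For every `b` there is `n₀` such that for all
`u ≥ n₀`, no multilinear formula of size `≤ u^b` over `2u` variables computes a full-rank polynomial
(Prop. 2.1 + `not_isFullRank_of_syntMultilinear`). [cite: Raz2006, Cor. 3.6] -/
theorem not_isFullRank_of_multilinearFormula {K : Type u} [Field K] (b : ℕ) :
    ∃ n₀ : ℕ, ∀ u : ℕ, n₀ ≤ u → ∀ e : WExpr K (Fin (2 * u)),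
      IsMultilinearFormula e → e.size ≤ u ^ b → ¬ IsFullRank u e.eval := by
  obtain ⟨n₀, h⟩ := not_isFullRank_of_syntMultilinear (K := K) b
  refine ⟨n₀, fun u hu e he hsize => ?_⟩
  obtain ⟨e', hs, hev, hsz⟩ := exists_syntMultilinear he
  rw [← hev]
  exact h u hu e' hs (hsz.trans hsize)

end Literature.Barriers.ValiantsHypothesis.RazFormula
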